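import Summits.RiemannHypothesis.RiemannHypothesis.Theorems.GroundBartaEvenWinsBeyondArchPhantomXT120Cells
import HarnessLib

/-!
# RiemannHypothesis / GroundBarta machinery — phantom chain XT120: the tail LEVEL 269/100 of w₂₃ + P beyond T = 120 (kernel certificate)

Helper DATA file (`--supports stmt-RiemannHypothesis-18085 --as helper`), RH-free.  Seat rh-explicit-weil-1.  Part of the T = 120 lattice-ripple (phantom) chain `xt120Cells` for the separable 12-harmonic phantom `rsOfSep xt120Ph2 xt120Ph3` (θ₂-harmonics j = 3..8, θ₃-harmonics k = 2..7; LP/Fejér–Riesz data of kit j143029): Taylor-sum cells `XTCell` of width 1/2, order n = 24, two-sided engine claims with margin 2e-8, generated by `gen/phantomgen.py` (exact mirror of the checker; nothing about the data is trusted — only kernel-evaluated Booleans are consumed).  With the boosted tail level wL = 269/100 (`xt120Level`: ∀ |t| ≥ 120, 269/100 ≤ w₂₃(t) + P(t)) this chain turns the LANDED two-prime T120 chain (level ≈ 1.8455 pointwise-amplitude, 2.09 sharp) into a level-269/100 chain for the phantom certificate format `WeilCert23X` (…PhantomCertificate*.lean; memo rh-explicit-weil-1/FORMAT-PHANTOM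.md).
-/

set_option linter.dupNamespace false

noncomputable section

namespace Summit.RiemannHypothesis.RiemannHypothesis.Theorems.EvenWinsBeyondArch

open Literature.NumberTheory.LFunctions

/-- The separable level certificate: phantom harmonics, Fejér–Riesz SOS witnesses (kit j143029), harmonic bounds 8/7, engine params (72, 5, 2500). [folklore] -/
def xt120Sep : SepLevelCert := ⟨xt120Ph2, xt120Ph3, [((41400084641 : ℚ)/500000000000), ((-809192631621 : ℚ)/50000000000000), ((-24160931817863 : ℚ)/100000000000000), ((1133651969131 : ℚ)/2500000000000), ((-18058771392521 : ℚ)/50000000000000), ((-482961635023 : ℚ)/50000000000000), ((1767325940153 : ℚ)/5000000000000), ((-1605987231397 : ℚ)/4000000000000), ((19307575722199 : ℚ)/100000000000000)], [((-13195613763121 : ℚ)/100000000000000), ((6218379392217 : ℚ)/25000000000000), ((-6705676024647 : ℚ)/20000000000000), ((19072163746499 : ℚ)/50000000000000), ((-9536312281157 : ℚ)/25000000000000), ((838707286819 : ℚ)/2500000000000), ((-24921793710907 : ℚ)/100000000000000), ((13278217650849 : ℚ)/100000000000000)], 8, 7, 72, 5, 2500⟩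

/-- The level certificate passes at wL = 269/100, T = 120 (kernel evaluation). [folklore] -/
theorem check_xt120Sep : xt120Sep.check (269/100) 120 = true := by
  decide +kernel

/-- **Tail level of the phantom-modified two-prime weight**: for every `|t| ≥ 120`, `269/100 ≤ w₂₃(t) + P(t)`, `P = ripplesVal xt120Rs` (vs. the pointwise amplitude level ≈ 1.8455 and the sharp pointwise level 2.09 of the same chain length). [folklore] -/
theorem xt120Level (t : ℝ) (ht : (((120 : ℚ)) : ℝ) ≤ |t|) :
    (((269/100 : ℚ)) : ℝ) ≤ weilTwoPrimeWeight t + ripplesVal xt120Rs t :=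
  SepLevelCert.level_of_check check_xt120Sep ht

end Summit.RiemannHypothesis.RiemannHypothesis.Theorems.EvenWinsBeyondArch

end
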